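import Summits.KontsevichZagierPeriods.KontsevichZagierPeriods.Theorems.LinRedNormalFormArrangementNormalFormSeparateSplit
import Summits.KontsevichZagierPeriods.KontsevichZagierPeriods.Theorems.LinRedNormalFormArrangementNormalFormSeparateTaylor

/-!
# The terminal step of the 3-d engine with fibres (stub `stub_separateHigh`, part `KTerminal`)

(Line `janus-bands`, crux `ArrangementNormalForm`, stub `stub_separateHigh` — separation in base
dimension `3` WITH `k` fibres, `JJ 3 k → closure (GG 2 1 k)`; part `KTerminal`: the fibred
version of part `Terminal` of `stub_separateThreeZero`.)

`SepThreeK.terminal` (registered as `separateThreeK_terminal`): a terminal representation of the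
contact-aware engine `SepThree.sepC_induction` over the base `ℝ²⁺¹` with `k` Janus fibres riding
along — separation shape with all active poles equal to `ℓ`, and the CONTACT INVARIANT: every
`x'`-letter with non-zero exponent vanishes on the closed cell only at points lying on every
active pole plane, some pole being active — is congruent modulo `KZ.relations` to a
`ℤ`-combination of elements of `GG 2 1 k`: Taylor split at `ℓ` (`separatePos_taylor`,
`separatePos_split`), whose termwise absolute convergence is the dimension-3 analytic lemma WITH
FIBRES under the RIM CONDITION in its first-disjunct form, taken as the hypothesis `hHI₃ₖ`:

  `hHI₃ₖ` = the registered statement of `separateThree_hI` (file `…SeparateThreeHIFinal`) with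
  the hypothesis `(hk : k = 0)` REMOVED and the rim hypothesis `hR` restricted to its first
  disjunct `n ≠ 0 ∧ y = ℓ(x')` (the only disjunct the engine ever produces; any version of the
  fibred lemma with a weaker `hR` implies this one by precomposition).
-/

noncomputable section

open Set MeasureTheory Filter Topology

namespace Summit.KontsevichZagierPeriods.ArrangementNormalForm.JanusBands

open Literature.NumberTheory.Transcendental

namespace SepThreeK

open SeparatePos MvPolynomial

/-- **Terminal theorem of the 3-d engine with fibres.** A terminal representation of the
contact-aware separation (polyhedral base cell in `ℝ³` times `k` Janus fibres, shape with all
active poles equal to `ℓ`, contact invariant for every `x'`-letter) is congruent modulo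
`KZ.relations` to a `ℤ`-combination of elements of `GG 2 1 k`, GIVEN the fibred dimension-3
termwise-convergence lemma `hHI₃ₖ` (rim condition in first-disjunct form): Taylor split at `ℓ`
(`separatePos_split`). -/
theorem terminal {k : ℕ}
    (hHI₃ₖ : ∀ (b k m m' n : ℕ) (s : KZ.IntegralRep (b + 1 + k)) (M : Fin m' → (Fin (b + 1) → ℚ) × ℚ) (L : Fin m → (Fin b → ℚ) × ℚ) (e : Fin m → ℕ) (p : MvPolynomial (Fin (b + 1)) ℚ) (ℓ : (Fin b → ℚ) × ℚ) (a : Fin k → Option ((Fin (b + 1) → ℚ) × ℚ)) (lo hi : Fin k → Fin k ⊕ ((Fin (b + 1) → ℚ) × ℚ)) (hpole : n ≠ 0 → ∀ z ∈ s.domain, (z (Fin.castAdd k (Fin.last b)) - (∑ i, (ℓ.1 i : ℝ) * z (Fin.castAdd k (Fin.castSucc i)) + (ℓ.2 : ℝ))) ≠ 0) (hbd : Bornology.IsBounded s.domain) (hdom : s.domain = {z | (∀ j, 0 < ∑ i, ((M j).1 i : ℝ) * z (Fin.castAdd k i) + ((M j).2 : ℝ)) ∧ ∀ i, Sum.elim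 (fun j => z (Fin.natAdd (b + 1) j)) (fun c => ∑ i', (c.1 i' : ℝ) * z (Fin.castAdd k i') + (c.2 : ℝ)) (lo i) < z (Fin.natAdd (b + 1) i) ∧ z (Fin.natAdd (b + 1) i) < Sum.elim (fun j => z (Fin.natAdd (b + 1) j)) (fun c => ∑ i', (c.1 i' : ℝ) * z (Fin.castAdd k i') + (c.2 : ℝ)) (hi i)}) (hint : EqOn s.integrand (fun z => MvPolynomial.aeval (fun i => z (Fin.castAdd k i)) p / (∏ j, (∑ i, ((L j).1 i : ℝ) * z (Fin.castAdd k (Fin.castSucc i)) + ((L j).2 : ℝ)) ^ e j) * (1 / (z (Fin.castAdd k (Fin.last b)) - (∑ i, (ℓ.1 i : ℝ) * z (Fin.castAdd k (Fin.castSucc i)) + (ℓ.2 : ℝ))) ^ n) * ∏ i, (a i).elim 1 (fun c => 1 / (z (Fin.natAdd (b + 1) i) - (∑ i', (c.1 i' : ℝ) * z (Fin.castAdd k i') + (c.2 : ℝ))))) s.domain) (N : ℕ) (q : ℕ → MvPolynomial (Fin b) ℚ) (hq : ∀ z : Fin (b + 1 + k) → ℝ, MvPolynomial.aeval (fun i =>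 z (Fin.castAdd k i)) p = ∑ i ∈ Finset.range N, MvPolynomial.aeval (fun i => z (Fin.castAdd k (Fin.castSucc i))) (q i) * (z (Fin.castAdd k (Fin.last b)) - (∑ i, (ℓ.1 i : ℝ) * z (Fin.castAdd k (Fin.castSucc i)) + (ℓ.2 : ℝ))) ^ i) (hb : b = 2) (hR : ∀ z ∈ closure s.domain, (∃ j, e j ≠ 0 ∧ (∑ i, ((L j).1 i : ℝ) * z (Fin.castAdd k (Fin.castSucc i)) + ((L j).2 : ℝ)) = 0) → n ≠ 0 ∧ z (Fin.castAdd k (Fin.last b)) = ∑ i, (ℓ.1 i : ℝ) * z (Fin.castAdd k (Fin.castSucc i)) + (ℓ.2 : ℝ)), ∀ i ∈ Finset.range N, IntegrableOn (fun z => MvPolynomial.aeval (fun i => z (Fin.castAdd k (Fin.castSucc i))) (q i) / (∏ j, (∑ i, ((L j).1 i : ℝ) * z (Fin.castAdd k (Fin.castSucc i)) + ((L j).2 : ℝ)) ^ e j) * ((z (Fin.castAdd k (Fin.last b)) - (∑ i, (ℓ.1 i : ℝ) * z (Fin.castAdd k (Fin.castSucc i)) + (ℓ.2 : ℝ))) ^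 i / (z (Fin.castAdd k (Fin.last b)) - (∑ i, (ℓ.1 i : ℝ) * z (Fin.castAdd k (Fin.castSucc i)) + (ℓ.2 : ℝ))) ^ n) * ∏ i, (a i).elim 1 (fun c => 1 / (z (Fin.natAdd (b + 1) i) - (∑ i', (c.1 i' : ℝ) * z (Fin.castAdd k i') + (c.2 : ℝ))))) s.domain)
    {m' r : ℕ} (M : Fin m' → (Fin (2 + 1) → ℚ) × ℚ)
    (p : MvPolynomial (Fin (2 + 1)) ℚ) (lam : Fin r → (Fin 2 → ℚ) × ℚ)
    (a : Fin k → Option ((Fin (2 + 1) → ℚ) × ℚ))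
    (lo up : Fin k → Fin k ⊕ ((Fin (2 + 1) → ℚ) × ℚ))
    {m : ℕ} (L : Fin m → (Fin 2 → ℚ) × ℚ) (e : Fin m → ℕ) (d : Fin r → ℕ)
    (s : KZ.IntegralRep (2 + 1 + k)) (ℓ : (Fin 2 → ℚ) × ℚ)
    (hbd : Bornology.IsBounded s.domain) (hdom : s.domain = gDom 2 k m' M lo up)
    (hint : EqOn s.integrand (shape 2 k p L e lam d a) s.domain)
    (hpole : ∀ j, d j ≠ 0 → ∀ z ∈ s.domain,
      z (Fin.castAdd k (Fin.last 2)) - affB 2 k (lam j) z ≠ 0)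
    (hℓ : ∀ j, d j ≠ 0 → lam j = ℓ)
    (hInv : ∀ l, e l ≠ 0 → ∀ z ∈ closure s.domain, affB 2 k (L l) z = 0 →
      (∃ i, d i ≠ 0) ∧ ∀ i, d i ≠ 0 → z (Fin.castAdd k (Fin.last 2)) = affB 2 k (lam i) z) :
    ∃ c ∈ AddSubgroup.closure (GGset 2 1 k), KZ.of s - c ∈ KZ.relations := by
  set n := ∑ j, d j with hn
  -- single-pole form of the integrand
  have hint' : EqOn s.integrand (fun z => MvPolynomial.aeval (fun i => z (Fin.castAdd k i)) p /
      (∏ j, (∑ i, ((L j).1 i : ℝ) * z (Fin.castAdd k (Fin.castSucc i)) + ((L j).2 : ℝ)) ^ e j) *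
      (1 / (z (Fin.castAdd k (Fin.last 2)) - (∑ i, (ℓ.1 i : ℝ) * z (Fin.castAdd k
        (Fin.castSucc i)) + (ℓ.2 : ℝ))) ^ n) *
      ∏ i, (a i).elim 1 (fun c => 1 / (z (Fin.natAdd (2 + 1) i) -
        (∑ i', (c.1 i' : ℝ) * z (Fin.castAdd k i') + (c.2 : ℝ))))) s.domain := by
    intro z hz
    rw [hint hz]
    simp only [shape, fib, affB, one_div]
    congr 2
    rw [← Finset.prod_pow_eq_pow_sum, ← Finset.prod_inv_distrib]
    refine Finset.prod_congr rfl fun j _ => ?_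
    by_cases hj : d j = 0
    · simp [hj]
    · rw [hℓ j hj]
  have hact : n ≠ 0 → ∃ j, d j ≠ 0 := fun h => by
    by_contra hall; push Not at hall
    exact h (Finset.sum_eq_zero fun j _ => hall j)
  have hpole' : n ≠ 0 → ∀ z ∈ s.domain, z (Fin.castAdd k (Fin.last 2)) -
      (∑ i, (ℓ.1 i : ℝ) * z (Fin.castAdd k (Fin.castSucc i)) + (ℓ.2 : ℝ)) ≠ 0 := fun h z hz => by
    obtain ⟨j, hj⟩ := hact h
    have := hpole j hj z hz
    rwa [hℓ j hj] at this
  -- the rim condition (first disjunct) from the contact invariant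
  have hR : ∀ z ∈ closure s.domain, (∃ j, e j ≠ 0 ∧ (∑ i, ((L j).1 i : ℝ) *
      z (Fin.castAdd k (Fin.castSucc i)) + ((L j).2 : ℝ)) = 0) →
      n ≠ 0 ∧ z (Fin.castAdd k (Fin.last 2)) = ∑ i, (ℓ.1 i : ℝ) * z (Fin.castAdd k
        (Fin.castSucc i)) + (ℓ.2 : ℝ) := by
    rintro z hz ⟨j, hej, h0⟩
    obtain ⟨⟨i, hi⟩, hall⟩ := hInv j hej z hz h0
    refine ⟨fun h => hi ((Finset.sum_eq_zero_iff.1 h) i (Finset.mem_univ _)), ?_⟩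
    have h1 := hall i hi
    rw [hℓ i hi] at h1
    exact h1
  obtain ⟨N, q, hq⟩ := separatePos_taylor 2 k p ℓ
  exact separatePos_split GGset (fun _ _ _ => rfl) 2 k m m' n s M L e p ℓ a lo up hpole' hbd hdom
    hint' N q hq (hHI₃ₖ 2 k m m' n s M L e p ℓ a lo up hpole' hbd hdom hint' N q hq rfl hR)

end SepThreeK

open SepThreeK SeparatePos in
/-- **Terminal theorem of the 3-d engine with fibres** (registered sub-goal of
`stub_separateHigh`, part `KTerminal`; see `SepThreeK.terminal`): under the fibred dimension-3
termwise-convergence lemma `hHI₃ₖ` (rim condition in first-disjunct form), a terminal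
representation of the contact-aware engine lies in `closure (GG 2 1 k)` modulo `KZ.relations`. -/
theorem separateThreeK_terminal (k : ℕ) (hHI₃ₖ : ∀ (b k m m' n : ℕ) (s : KZ.IntegralRep (b + 1 + k)) (M : Fin m' → (Fin (b + 1) → ℚ) × ℚ) (L : Fin m → (Fin b → ℚ) × ℚ) (e : Fin m → ℕ) (p : MvPolynomial (Fin (b + 1)) ℚ) (ℓ : (Fin b → ℚ) × ℚ) (a : Fin k → Option ((Fin (b + 1) → ℚ) × ℚ)) (lo hi : Fin k → Fin k ⊕ ((Fin (b + 1) → ℚ) × ℚ)) (hpole : n ≠ 0 → ∀ z ∈ s.domain, (z (Fin.castAdd k (Fin.last b)) - (∑ i, (ℓ.1 i : ℝ) * z (Fin.castAdd k (Fin.castSucc i)) + (ℓ.2 : ℝ))) ≠ 0) (hbd : Bornology.IsBounded s.domain) (hdom : s.domain = {z | (∀ j, 0 < ∑ i, ((M j).1 i : ℝ) * z (Fin.castAdd k i) + ((M j).2 : ℝ)) ∧ ∀ i, Sum.elim (fun j => z (Fin.natAdd (b + 1) j)) (fun c => ∑ i', (c.1 i' : ℝ) * z (Fin.castAdd k i')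 + (c.2 : ℝ)) (lo i) < z (Fin.natAdd (b + 1) i) ∧ z (Fin.natAdd (b + 1) i) < Sum.elim (fun j => z (Fin.natAdd (b + 1) j)) (fun c => ∑ i', (c.1 i' : ℝ) * z (Fin.castAdd k i') + (c.2 : ℝ)) (hi i)}) (hint : EqOn s.integrand (fun z => MvPolynomial.aeval (fun i => z (Fin.castAdd k i)) p / (∏ j, (∑ i, ((L j).1 i : ℝ) * z (Fin.castAdd k (Fin.castSucc i)) + ((L j).2 : ℝ)) ^ e j) * (1 / (z (Fin.castAdd k (Fin.last b)) - (∑ i, (ℓ.1 i : ℝ) * z (Fin.castAdd k (Fin.castSucc i)) + (ℓ.2 : ℝ))) ^ n) * ∏ i, (a i).elim 1 (fun c => 1 / (z (Fin.natAdd (b + 1) i) - (∑ i', (c.1 i' : ℝ) * z (Fin.castAdd k i') + (c.2 : ℝ))))) s.domain) (N : ℕ) (q : ℕ → MvPolynomial (Fin b) ℚ) (hq : ∀ z : Fin (b + 1 + k) → ℝ, MvPolynomial.aeval (fun i => z (Fin.castAdd k i)) p = ∑ i ∈ Finset.range N, MvPolynomial.aeval (fun i => z (Fin.castAdd k (Fin.castSucc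 i))) (q i) * (z (Fin.castAdd k (Fin.last b)) - (∑ i, (ℓ.1 i : ℝ) * z (Fin.castAdd k (Fin.castSucc i)) + (ℓ.2 : ℝ))) ^ i) (hb : b = 2) (hR : ∀ z ∈ closure s.domain, (∃ j, e j ≠ 0 ∧ (∑ i, ((L j).1 i : ℝ) * z (Fin.castAdd k (Fin.castSucc i)) + ((L j).2 : ℝ)) = 0) → n ≠ 0 ∧ z (Fin.castAdd k (Fin.last b)) = ∑ i, (ℓ.1 i : ℝ) * z (Fin.castAdd k (Fin.castSucc i)) + (ℓ.2 : ℝ)), ∀ i ∈ Finset.range N, IntegrableOn (fun z => MvPolynomial.aeval (fun i => z (Fin.castAdd k (Fin.castSucc i))) (q i) / (∏ j, (∑ i, ((L j).1 i : ℝ) * z (Fin.castAdd k (Fin.castSucc i)) + ((L j).2 : ℝ)) ^ e j) * ((z (Fin.castAdd k (Fin.last b)) - (∑ i, (ℓ.1 i : ℝ) * z (Fin.castAdd k (Fin.castSucc i)) + (ℓ.2 : ℝ))) ^ i / (z (Fin.castAdd k (Fin.last b)) - (∑ i, (ℓ.1 i : ℝ) * z (Fin.castAdd k (Fin.castSucc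 i)) + (ℓ.2 : ℝ))) ^ n) * ∏ i, (a i).elim 1 (fun c => 1 / (z (Fin.natAdd (b + 1) i) - (∑ i', (c.1 i' : ℝ) * z (Fin.castAdd k i') + (c.2 : ℝ))))) s.domain) (m' r : ℕ) (M : Fin m' → (Fin (2 + 1) → ℚ) × ℚ) (p : MvPolynomial (Fin (2 + 1)) ℚ) (lam : Fin r → (Fin 2 → ℚ) × ℚ) (a : Fin k → Option ((Fin (2 + 1) → ℚ) × ℚ)) (lo up : Fin k → Fin k ⊕ ((Fin (2 + 1) → ℚ) × ℚ)) (m : ℕ) (L : Fin m → (Fin 2 → ℚ) × ℚ) (e : Fin m → ℕ) (d : Fin r → ℕ) (s : KZ.IntegralRep (2 + 1 + k)) (ℓ : (Fin 2 → ℚ) × ℚ) (hbd : Bornology.IsBounded s.domain) (hdom : s.domain = SeparatePos.gDom 2 k m' M lo up) (hint : EqOn s.integrand (SeparatePos.shape 2 k p L e lam d a) s.domain) (hpole : ∀ j, d j ≠ 0 → ∀ z ∈ s.domain, z (Fin.castAdd k (Fin.last 2)) - SeparatePos.affB 2 k (lam j) z ≠ 0) (hℓ : ∀ j, d j ≠ 0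 → lam j = ℓ) (hInv : ∀ l, e l ≠ 0 → ∀ z ∈ closure s.domain, SeparatePos.affB 2 k (L l) z = 0 → (∃ i, d i ≠ 0) ∧ ∀ i, d i ≠ 0 → z (Fin.castAdd k (Fin.last 2)) = SeparatePos.affB 2 k (lam i) z) : ∃ c ∈ AddSubgroup.closure (SeparatePos.GGset 2 1 k), KZ.of s - c ∈ KZ.relations :=
  terminal hHI₃ₖ M p lam a lo up L e d s ℓ hbd hdom hint hpole hℓ hInv

end Summit.KontsevichZagierPeriods.ArrangementNormalForm.JanusBands
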